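import Mathlib
import HarnessLib

/-!
# Wood's von Mises–Fisher rejection sampler: the engine's acceptance exponent is a genuine thinning

HONEST FRAMING: exact (Metropolis-corrected) sampling algorithms for lattice gauge theory;
figures of merit are autocorrelation/cost numbers at stated couplings and volumes; no
continuum-physics claim.

Venture `LatticeQCDFlow` (cell pub-lqcd), topic `Exactness`, FANOUT row 9 (eng-latcore, the
engine `latflow.core`).  NEW WORK of the cell over Mathlib; nothing is cited as a fact.  Printed
counterpart, NAMED ONLY: Wood, *Simulation of the von Mises Fisher distribution*, Comm. Statist.
Simulation Comput. 23 (1994) 157–164.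

The CP(N−1) SITE heat bath of `latflow.core` (`cpn_2d.py` `sample_vmf_cos`, C `csrc/cpn_kernel.c`
`rng_vmf_w`) draws the cosine `w = m·x` of a von Mises–Fisher vector on `S^{d−1}` (`d = 2N`,
concentration `κ = 2Nβ|F| ≥ 0`) by Wood's rejection loop: with `δ = d − 1`,
`b = (−2κ + √(4κ² + δ²))/δ`, `x₀ = (1 − b)/(1 + b)`, `c = κ x₀ + δ log(1 − x₀²)`, it proposes
`W = (1 − (1+b)Z)/(1 − (1−b)Z)` with `Z ∼ Beta(δ/2, δ/2)` and ACCEPTS iff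
`κ W + δ log(1 − x₀ W) − c ≥ log U`, `U` uniform.  For this test to be a thinning (acceptance
probability `exp(h(W) − c)` AT MOST ONE, as `RejectionSampling.loopLaw_thinning` requires), the
exponent `h(w) = κ w + δ log(1 − x₀ w)` must be maximal at `w = x₀` — which is exactly what Wood's
choice of `b` arranges.  This file proves it, for every `κ ≥ 0`, `δ > 0`, `w ∈ [−1, 1]`:

* `woodB`, `woodX0`, `woodC`, `woodH` — the engine's constants and exponent, symbol for symbol;
* `woodB_quadratic` (`δ b² + 4κ b = δ`), `woodB_pos`, `woodB_le_one`, `woodX0_nonneg`,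
  `woodX0_lt_one`, **`woodX0_stationary`** (`κ(1 − x₀²) = δ x₀`: `h′(x₀) = 0`),
  `one_sub_woodX0_mul_pos` (`1 − x₀ w > 0` on `[−1, 1]`: the C guard `t <= 0 → continue` never fires);
* **`woodH_le_woodC`** — `h(w) ≤ c = h(x₀)` on `[−1, 1]` (concavity: `log t ≤ t − 1`), with
  equality at `x₀` (`woodH_woodX0`); **`wood_accept_le_one`** — `exp(h(w) − c) ≤ 1`.

NOT CLAIMED (scoped for a successor, see row 9's HANDOFF): the law of the proposal `W` (a Möbius
image of `Beta(δ/2, δ/2)`, density `∝ (1−w²)^{(δ−2)/2}(1 − x₀w)^{−δ}`), hence the loop's output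
`∝ (1 − w²)^{(d−3)/2} e^{κ w}` via `RejectionSampling.loopLaw_thinning`, and its identification
with the cosine marginal of the vMF law on the sphere (row 7's `SphereAxisDisintegration.lean`
gives the `κ = 0` marginal `∝ sin^{d−2}θ dθ`); the Beta draw itself (numpy `rng.beta` /
Marsaglia–Tsang gammas in C); floating point.
-/

namespace Summit.Ventures.LatticeQCDFlow.Exactness

open Real Set

section Wood

variable {κ δ : ℝ}

/-- Wood's `b = (−2κ + √(4κ² + δ²))/δ`. -/
noncomputable def woodB (κ δ : ℝ) : ℝ := (-2 * κ + Real.sqrt (4 * κ ^ 2 + δ ^ 2)) / δ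

/-- Wood's `x₀ = (1 − b)/(1 + b)`. -/
noncomputable def woodX0 (κ δ : ℝ) : ℝ := (1 - woodB κ δ) / (1 + woodB κ δ)

/-- Wood's `c = κ x₀ + δ log(1 − x₀²)`. -/
noncomputable def woodC (κ δ : ℝ) : ℝ := κ * woodX0 κ δ + δ * Real.log (1 - woodX0 κ δ ^ 2)

/-- The log acceptance ratio `h(w) = κ w + δ log(1 − x₀ w)` (the engine tests `h(W) − c ≥ log U`). -/
noncomputable def woodH (κ δ w : ℝ) : ℝ := κ * w + δ * Real.log (1 - woodX0 κ δ * w)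

/-- The square root in `b` exceeds `2κ` (strictly, since `δ ≠ 0`) and is at most `2κ + δ`. -/
theorem wood_sqrt_bounds (hκ : 0 ≤ κ) (hδ : 0 < δ) :
    2 * κ < Real.sqrt (4 * κ ^ 2 + δ ^ 2) ∧ Real.sqrt (4 * κ ^ 2 + δ ^ 2) ≤ 2 * κ + δ := by
  constructor
  · have h : (2 * κ) ^ 2 < 4 * κ ^ 2 + δ ^ 2 := by nlinarith
    calc 2 * κ = Real.sqrt ((2 * κ) ^ 2) := (Real.sqrt_sq (by linarith)).symm
      _ < Real.sqrt (4 * κ ^ 2 + δ ^ 2) := Real.sqrt_lt_sqrt (sq_nonneg _) h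
  · rw [Real.sqrt_le_left (by linarith)]
    nlinarith

/-- `b > 0`. -/
theorem woodB_pos (hκ : 0 ≤ κ) (hδ : 0 < δ) : 0 < woodB κ δ := by
  have h := (wood_sqrt_bounds hκ hδ).1
  exact div_pos (by linarith) hδ

/-- `b ≤ 1`. -/
theorem woodB_le_one (hκ : 0 ≤ κ) (hδ : 0 < δ) : woodB κ δ ≤ 1 := by
  have h := (wood_sqrt_bounds hκ hδ).2
  rw [woodB, div_le_one hδ]
  linarith

/-- **`b` solves Wood's quadratic**: `δ b² + 4κ b = δ`. -/
theorem woodB_quadratic (hδ : 0 < δ) : δ * woodB κ δ ^ 2 + 4 * κ * woodB κ δ = δ := by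
  have hs : Real.sqrt (4 * κ ^ 2 + δ ^ 2) ^ 2 = 4 * κ ^ 2 + δ ^ 2 := Real.sq_sqrt (by positivity)
  set s := Real.sqrt (4 * κ ^ 2 + δ ^ 2) with hsdef
  have hδ0 : δ ≠ 0 := hδ.ne'
  rw [woodB, ← sub_eq_zero]
  have : δ * ((-2 * κ + s) / δ) ^ 2 + 4 * κ * ((-2 * κ + s) / δ) - δ =
      ((-2 * κ + s) ^ 2 + 4 * κ * (-2 * κ + s) - δ ^ 2) / δ := by
    field_simp
  rw [this, show (-2 * κ + s) ^ 2 + 4 * κ * (-2 * κ + s) - δ ^ 2 = s ^ 2 - (4 * κ ^ 2 + δ ^ 2) by ring,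
    hs, sub_self, zero_div]

/-- `0 ≤ x₀`. -/
theorem woodX0_nonneg (hκ : 0 ≤ κ) (hδ : 0 < δ) : 0 ≤ woodX0 κ δ :=
  div_nonneg (by linarith [woodB_le_one hκ hδ]) (by linarith [woodB_pos hκ hδ])

/-- `x₀ < 1`. -/
theorem woodX0_lt_one (hκ : 0 ≤ κ) (hδ : 0 < δ) : woodX0 κ δ < 1 := by
  have hb := woodB_pos hκ hδ
  rw [woodX0, div_lt_one (by linarith)]
  linarith

/-- **Stationarity**: `κ (1 − x₀²) = δ x₀`, i.e. `h′(x₀) = 0` — the point of Wood's choice of `b`. -/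
theorem woodX0_stationary (hκ : 0 ≤ κ) (hδ : 0 < δ) :
    κ * (1 - woodX0 κ δ ^ 2) = δ * woodX0 κ δ := by
  have hb := woodB_pos hκ hδ
  have hq := woodB_quadratic (κ := κ) hδ
  have h1 : (1 + woodB κ δ) ≠ 0 := by linarith
  rw [← sub_eq_zero]
  have : κ * (1 - woodX0 κ δ ^ 2) - δ * woodX0 κ δ =
      (4 * κ * woodB κ δ - δ * (1 - woodB κ δ ^ 2)) / (1 + woodB κ δ) ^ 2 := by
    rw [woodX0]
    field_simp
    ring
  rw [this, show 4 * κ * woodB κ δ - δ * (1 - woodB κ δ ^ 2) = 0 by linear_combination hq, zero_div]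

/-- On `[−1, 1]` the argument of the logarithm is positive: `1 − x₀ w > 0` (the C guard
`t <= 0 → continue` never fires in exact arithmetic). -/
theorem one_sub_woodX0_mul_pos (hκ : 0 ≤ κ) (hδ : 0 < δ) {w : ℝ} (hw : w ∈ Icc (-1 : ℝ) 1) :
    0 < 1 - woodX0 κ δ * w := by
  have h0 := woodX0_nonneg hκ hδ
  have h1 := woodX0_lt_one hκ hδ
  have : woodX0 κ δ * w ≤ woodX0 κ δ * 1 := mul_le_mul_of_nonneg_left hw.2 h0
  linarith

/-- `h(x₀) = c`. -/
theorem woodH_woodX0 : woodH κ δ (woodX0 κ δ) = woodC κ δ := by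
  rw [woodH, woodC, sq]

/-- **Wood's envelope inequality**: `h(w) ≤ c` for every `w ∈ [−1, 1]` (`κ ≥ 0`, `δ > 0`).  Proof:
`log t ≤ t − 1` at `t = (1 − x₀w)/(1 − x₀²)` and stationarity. -/
theorem woodH_le_woodC (hκ : 0 ≤ κ) (hδ : 0 < δ) {w : ℝ} (hw : w ∈ Icc (-1 : ℝ) 1) :
    woodH κ δ w ≤ woodC κ δ := by
  have hx0 := woodX0_nonneg hκ hδ
  have hx1 := woodX0_lt_one hκ hδ
  have hst := woodX0_stationary hκ hδ
  have ht : 0 < 1 - woodX0 κ δ * w := one_sub_woodX0_mul_pos hκ hδ hw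
  have hs : 0 < 1 - woodX0 κ δ ^ 2 := by nlinarith
  have hlog : Real.log (1 - woodX0 κ δ * w) - Real.log (1 - woodX0 κ δ ^ 2) ≤
      (1 - woodX0 κ δ * w) / (1 - woodX0 κ δ ^ 2) - 1 := by
    rw [← Real.log_div ht.ne' hs.ne']
    exact Real.log_le_sub_one_of_pos (div_pos ht hs)
  have hmul := mul_le_mul_of_nonneg_left hlog hδ.le
  have hkey : δ * ((1 - woodX0 κ δ * w) / (1 - woodX0 κ δ ^ 2) - 1) = κ * (woodX0 κ δ - w) := by
    have : (1 - woodX0 κ δ * w) / (1 - woodX0 κ δ ^ 2) - 1 =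
        woodX0 κ δ * (woodX0 κ δ - w) / (1 - woodX0 κ δ ^ 2) := by
      field_simp
      ring
    rw [this, show δ * (woodX0 κ δ * (woodX0 κ δ - w) / (1 - woodX0 κ δ ^ 2)) =
      (δ * woodX0 κ δ) * (woodX0 κ δ - w) / (1 - woodX0 κ δ ^ 2) by ring, ← hst]
    field_simp
  rw [woodH, woodC]
  rw [hkey] at hmul
  nlinarith [hmul]

/-- **The engine's acceptance probability is at most one**: `exp(h(w) − c) ≤ 1` on `[−1, 1]`. -/
theorem wood_accept_le_one (hκ : 0 ≤ κ) (hδ : 0 < δ) {w : ℝ} (hw : w ∈ Icc (-1 : ℝ) 1) :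
    Real.exp (woodH κ δ w - woodC κ δ) ≤ 1 :=
  Real.exp_le_one_iff.mpr (sub_nonpos.mpr (woodH_le_woodC hκ hδ hw))

end Wood

end Summit.Ventures.LatticeQCDFlow.Exactness
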